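import Summits.MatrixMultiplication.MatrixMultiplication.Theorems.FarEdgeDescentSpectralWorlds
import HarnessLib

/-!
# FarEdgeDescent — 3D-LAWFUL SPECTRAL WORLDS (III): the hyperbola world `W_hyp`

`W_hyp(a,b,c) := max(Σ − m, 5Σ/8 + M/4 + M²/(8Σ))` (`Σ = a+b+c`, `m = min`, `M = max`).  It is the support
function of `conv(T ∪ S₃·{(½ + √(B/2) − B, 1 − B, ½ + √(B/2) − B) : 0 < B ≤ 1/8})` — three dark ARCS
accumulating tangentially at the midpoints `S₃·(½,1,½)` of the top edges of the hexagon `T` (the `sup` over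
`B` is attained at `B = (Σ−M)²/(8Σ²)` and evaluates to the closed form).  Laws proved: symmetry, homogeneity,
subadditivity on `ℝ³₊` (the quadratic-over-linear term by the Engel inequality), convex combinations,
sandwich.  Pencil: `e_W(x) = 1/(2(x+2))` for `x ≥ 1` — NO saturated shape (round contact W1),
`AnchoredLogConvexity`-shape HOLDS (`⟺ (m−1)² ≥ 0`), `PowerAmortisation`-shape holds (`δ = 1`, `C = 1/2`),
`SmoothProfile`-shape holds; `ω_W = 13/6`; near plateau `[0, 7/10]` so `α_W ∈ (0.70, 0.75)` — exactly
`α_W = (2√11−3)/5`, where the near dark branch `5(x+2)/8 + 1/4 + 1/(8(x+2))` crosses `2` TRANSVERSALLY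
(right slope `(7√11−22)/2 > 0`): the near departure is a CORNER.  Theorem
compatibility: VXXZ table, `ω(1,1/3,5/3) = 8/3`, Coppersmith tight shapes with the `t`-dependent length
`r = 4/(1−t)`.  The 3D-lawful certificate that the GENERIC leaves (`AnchoredLogConvexity`, and the asides
`PowerAmortisation`, `SmoothProfile`) do not give `S` without the SPECIAL leaf `FiniteSaturation`
(gen 17's `expFloor` world was 1D).  Cell [N2 ∧ W1] (corner near, round far; census-1 g12 audit).
-/

set_option linter.dupNamespace false

noncomputable section

namespace Summit.MatrixMultiplication.MatrixMultiplication.Theorems.FarEdgeDescentSpectralHyp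

open Literature.Computability.AlgebraicComplexity
open Summit.MatrixMultiplication.MatrixMultiplication.Theorems.FarEdgeDescentSpectralWorlds
open Filter Topology Set

/-! ## §3 The HYPERBOLA world `W_hyp` — three dark arcs kissing the edge midpoints of `T`

`W_hyp(a,b,c) := max( Σ − m , 5Σ/8 + M/4 + M²/(8Σ) )`.  It is the support function of
`conv(T ∪ S₃·{(½ + √(B/2) − B, 1 − B, ½ + √(B/2) − B) : 0 < B ≤ 1/8})`, a dark ARC accumulating tangentially
at the midpoint `(½,1,½)` of a top edge of `T` (the sup over `B` is attained at `B = (Σ−M)²/(8Σ²)` and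
evaluates to the closed form).  Pencil: `e_W(x) = 1/(2(x+2))` for `x ≥ 1` — NO saturated shape (round contact, W1),
`AnchoredLogConvexity`-shape HOLDS (`(m−1)² ≥ 0`), `PowerAmortisation`-shape holds (`δ = 1`),
`SmoothProfile`-shape holds; `ω_W = 13/6`, `α_W ∈ (0.70, 0.75)` (root of `5x² + 6x − 7`).  A 3D-lawful world
of `ALC ∧ ¬FS ∧ ¬S`: the special leaf is load-bearing. -/

section Hyp

variable {W : ℝ → ℝ → ℝ → ℝ}
  (hW : ∀ a b c : ℝ, W a b c = max (a + b + c - min a (min b c))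
    (5 * (a + b + c) / 8 + max a (max b c) / 4 + max a (max b c) ^ 2 / (8 * (a + b + c))))
include hW

/-- THE 3D LAWS of `W_hyp` (bundled): `S₃`-symmetry, positive homogeneity (the quadratic-over-linear term
scales linearly; `0·W = W(0) = 0`), subadditivity on `ℝ³₊` (Engel inequality for the `M²/(8Σ)` term), joint
convexity on `ℝ³₊` (convex-combination form), and the sandwich `max(a+b,b+c,c+a) ≤ W ≤ a+b+c` on `ℝ³₊`. -/
theorem hyp_laws :
    (∀ a b c : ℝ, W a b c = W b c a ∧ W a b c = W b a c) ∧
    (∀ ν : ℝ, 0 ≤ ν → ∀ a b c : ℝ, W (ν * a) (ν * b) (ν * c) = ν * W a b c) ∧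
    (∀ a b c a' b' c' : ℝ, 0 ≤ a → 0 ≤ b → 0 ≤ c → 0 ≤ a' → 0 ≤ b' → 0 ≤ c' →
      W (a + a') (b + b') (c + c') ≤ W a b c + W a' b' c') ∧
    (∀ s t : ℝ, 0 ≤ s → 0 ≤ t → ∀ a b c a' b' c' : ℝ, 0 ≤ a → 0 ≤ b → 0 ≤ c → 0 ≤ a' → 0 ≤ b' →
      0 ≤ c' → W (s * a + t * a') (s * b + t * b') (s * c + t * c') ≤ s * W a b c + t * W a' b' c') ∧
    (∀ a b c : ℝ, 0 ≤ a → 0 ≤ b → 0 ≤ c →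
      max (a + b) (max (b + c) (c + a)) ≤ W a b c ∧ W a b c ≤ a + b + c) := by
  have zero : W 0 0 0 = 0 := by rw [hW]; norm_num
  have hom : ∀ ν : ℝ, 0 ≤ ν → ∀ a b c : ℝ, W (ν * a) (ν * b) (ν * c) = ν * W a b c := by
    intro ν hν a b c
    rw [hW, hW, min3_mul hν, max3_mul hν, mul_max_of_nonneg (a + b + c - min a (min b c)) _ hν]
    have e : ν * a + ν * b + ν * c = ν * (a + b + c) := by ring
    rw [e]
    congr 1
    · ring
    · by_cases hS : a + b + c = 0
      · rw [hS]; simp; ring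
      · rcases eq_or_lt_of_le hν with rfl | hν'
        · simp
        · field_simp
  have subadd : ∀ a b c a' b' c' : ℝ, 0 ≤ a → 0 ≤ b → 0 ≤ c → 0 ≤ a' → 0 ≤ b' → 0 ≤ c' →
      W (a + a') (b + b') (c + c') ≤ W a b c + W a' b' c' := by
    intro a b c a' b' c' ha hb hc ha' hb' hc'
    rcases eq_or_lt_of_le (add_nonneg (add_nonneg ha hb) hc) with hS | hS
    · have h1 : a = 0 := by linarith
      have h2 : b = 0 := by linarith
      have h3 : c = 0 := by linarith
      subst h1; subst h2; subst h3
      simp only [zero_add, zero]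
      exact le_rfl
    rcases eq_or_lt_of_le (add_nonneg (add_nonneg ha' hb') hc') with hS' | hS'
    · have h1 : a' = 0 := by linarith
      have h2 : b' = 0 := by linarith
      have h3 : c' = 0 := by linarith
      subst h1; subst h2; subst h3
      simp only [add_zero, zero]
      exact le_rfl
    have key : ∀ {S S' M M' N : ℝ}, 0 < S → 0 < S' → 0 ≤ N → N ≤ M + M' →
        5 * (S + S') / 8 + N / 4 + N ^ 2 / (8 * (S + S')) ≤
          (5 * S / 8 + M / 4 + M ^ 2 / (8 * S)) + (5 * S' / 8 + M' / 4 + M' ^ 2 / (8 * S')) := by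
      intro S S' M M' N hS hS' hN hNM
      have sq : N ^ 2 ≤ (M + M') ^ 2 := by nlinarith
      have d1 : N ^ 2 / (8 * (S + S')) ≤ (M + M') ^ 2 / (8 * (S + S')) :=
        div_le_div_of_nonneg_right sq (by positivity)
      have d2 : (M + M') ^ 2 / (8 * S + 8 * S') ≤ M ^ 2 / (8 * S) + M' ^ 2 / (8 * S') :=
        engel (by positivity) (by positivity)
      rw [← mul_add] at d2
      linarith
    have eS : a + a' + (b + b') + (c + c') = (a + b + c) + (a' + b' + c') := by ring
    rw [hW, hW, hW, eS]
    refine max_subadd_of_le (by linarith [min3_superadd a b c a' b' c']) ?_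
    exact key hS hS' ((add_nonneg ha ha').trans (le_max3₁ _ _ _)) (max3_subadd a b c a' b' c')
  refine ⟨fun a b c => ?_, hom, subadd, fun s t hs ht a b c a' b' c' ha hb hc ha' hb' hc' => ?_,
    fun a b c ha hb hc => ?_⟩
  · refine ⟨?_, ?_⟩ <;> rw [hW, hW] <;> ac_rfl
  · rw [← hom s hs, ← hom t ht]
    exact subadd _ _ _ _ _ _ (mul_nonneg hs ha) (mul_nonneg hs hb) (mul_nonneg hs hc) (mul_nonneg ht ha')
      (mul_nonneg ht hb') (mul_nonneg ht hc')
  · rw [hW, ← sum_sub_min3]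
    have hm : 0 ≤ min a (min b c) := le_min ha (le_min hb hc)
    have hM0 : 0 ≤ max a (max b c) := ha.trans (le_max3₁ _ _ _)
    have hM : max a (max b c) ≤ a + b + c := max_le (by linarith) (max_le (by linarith) (by linarith))
    refine ⟨le_max_left _ _, max_le (by linarith) ?_⟩
    rcases eq_or_lt_of_le (add_nonneg (add_nonneg ha hb) hc) with hS | hS
    · rw [← hS]
      have : max a (max b c) = 0 := le_antisymm (hS ▸ hM) hM0
      rw [this]; norm_num
    · have h1 : max a (max b c) ^ 2 ≤ (a + b + c) ^ 2 := by nlinarith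
      have h2 : max a (max b c) ^ 2 / (8 * (a + b + c)) ≤ (a + b + c) ^ 2 / (8 * (a + b + c)) :=
        div_le_div_of_nonneg_right h1 (by positivity)
      have h3 : (a + b + c) ^ 2 / (8 * (a + b + c)) = (a + b + c) / 8 := by
        field_simp
      linarith

/-- PENCIL (`x ≥ 0`), one formula: `W_hyp(1,x,1) = max(2, x+1, N(x), D(x))` with the near dark branch
`N(x) = 5(x+2)/8 + 1/4 + 1/(8(x+2))` and the far dark branch `D(x) = 5(x+2)/8 + x/4 + x²/(8(x+2))`. -/
theorem hyp_pencil {x : ℝ} (hx : 0 ≤ x) :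
    W 1 x 1 = max (max 2 (x + 1))
      (max (5 * (1 + x + 1) / 8 + 1 / 4 + 1 ^ 2 / (8 * (1 + x + 1)))
        (5 * (1 + x + 1) / 8 + x / 4 + x ^ 2 / (8 * (1 + x + 1)))) := by
  rw [hW]
  have hp : 0 < 8 * (1 + x + 1) := by linarith
  rcases le_total x 1 with h | h
  · have hm : min (1 : ℝ) (min x 1) = x := by rw [min_eq_left h, min_eq_right h]
    have hM : max (1 : ℝ) (max x 1) = 1 := by rw [max_eq_right h, max_self]
    have hd : x ^ 2 / (8 * (1 + x + 1)) ≤ 1 ^ 2 / (8 * (1 + x + 1)) :=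
      div_le_div_of_nonneg_right (by nlinarith) hp.le
    rw [hm, hM, max_eq_left (by linarith : x + 1 ≤ 2),
      max_eq_left (show 5 * (1 + x + 1) / 8 + x / 4 + x ^ 2 / (8 * (1 + x + 1)) ≤
        5 * (1 + x + 1) / 8 + 1 / 4 + 1 ^ 2 / (8 * (1 + x + 1)) by linarith)]
    congr 1; ring
  · have hm : min (1 : ℝ) (min x 1) = 1 := by rw [min_eq_right h, min_self]
    have hM : max (1 : ℝ) (max x 1) = x := by rw [max_eq_left h, max_eq_right h]
    have hd : 1 ^ 2 / (8 * (1 + x + 1)) ≤ x ^ 2 / (8 * (1 + x + 1)) :=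
      div_le_div_of_nonneg_right (by nlinarith) hp.le
    rw [hm, hM, max_eq_right (by linarith : 2 ≤ x + 1),
      max_eq_right (show 5 * (1 + x + 1) / 8 + 1 / 4 + 1 ^ 2 / (8 * (1 + x + 1)) ≤
        5 * (1 + x + 1) / 8 + x / 4 + x ^ 2 / (8 * (1 + x + 1)) by linarith)]
    congr 1; ring

/-- PENCIL, far edge in closed form: `W_hyp(1,x,1) = x + 1 + 1/(2(x+2))` for `x ≥ 1` — positive excess at
EVERY far shape. -/
theorem hyp_far {x : ℝ} (hx : 1 ≤ x) : W 1 x 1 = x + 1 + 1 / (2 * (x + 2)) := by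
  rw [hW]
  have hm : min (1 : ℝ) (min x 1) = 1 := by rw [min_eq_right hx, min_self]
  have hM : max (1 : ℝ) (max x 1) = x := by rw [max_eq_left hx, max_eq_right hx]
  rw [hm, hM]
  have hx2 : (1 : ℝ) + x + 1 ≠ 0 := by linarith
  have e : 5 * (1 + x + 1) / 8 + x / 4 + x ^ 2 / (8 * (1 + x + 1)) = x + 1 + 1 / (2 * (x + 2)) := by
    field_simp
    ring
  have hpos : 0 < 1 / (2 * (x + 2)) := by positivity
  rw [e, max_eq_right (by linarith)]

/-- PENCIL, near plateau: `W_hyp(1,x,1) = 2` on `[0, 7/10]` (so `α_W ≥ 0.7 > 0.321334`), and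
`W_hyp(1,3/4,1) > 2` (`α_W < 3/4`); `ω_W = 13/6`. -/
theorem hyp_near : (∀ x : ℝ, 0 ≤ x → x ≤ 7 / 10 → W 1 x 1 = 2) ∧ 2 < W 1 (3 / 4) 1 ∧ W 1 1 1 = 13 / 6 := by
  refine ⟨fun x h0 h1 => ?_, ?_, ?_⟩
  · rw [hyp_pencil hW h0, max_eq_left (by linarith : x + 1 ≤ 2)]
    have hp : 0 < 8 * (1 + x + 1) := by linarith
    have hd : x ^ 2 / (8 * (1 + x + 1)) ≤ 1 ^ 2 / (8 * (1 + x + 1)) :=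
      div_le_div_of_nonneg_right (by nlinarith) hp.le
    have key : 5 * (1 + x + 1) / 8 + 1 / 4 + 1 ^ 2 / (8 * (1 + x + 1)) - 2 =
        (5 * x ^ 2 + 6 * x - 7) / (8 * (1 + x + 1)) := by
      field_simp
      ring
    have hneg : (5 * x ^ 2 + 6 * x - 7) / (8 * (1 + x + 1)) ≤ 0 :=
      div_nonpos_of_nonpos_of_nonneg (by nlinarith) hp.le
    rw [max_eq_left (show 5 * (1 + x + 1) / 8 + x / 4 + x ^ 2 / (8 * (1 + x + 1)) ≤
        5 * (1 + x + 1) / 8 + 1 / 4 + 1 ^ 2 / (8 * (1 + x + 1)) by linarith),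
      max_eq_left (show 5 * (1 + x + 1) / 8 + 1 / 4 + 1 ^ 2 / (8 * (1 + x + 1)) ≤ 2 by linarith)]
  · rw [hW]; norm_num [min_def, max_def]
  · rw [hyp_far hW le_rfl]; norm_num

/-- SHAPES in `W_hyp`: NO saturated far shape (`FiniteSaturation`-shape FAILS; round contact);
`AnchoredLogConvexity`-shape HOLDS; `PowerAmortisation`-shape holds (`δ = 1`, `C = 1/2`);
`SmoothProfile`-shape holds. -/
theorem hyp_shapes :
    (∀ x : ℝ, 1 ≤ x → x + 1 < W 1 x 1) ∧
    (∀ m : ℝ, 1 < m → (W 1 m 1 - (m + 1)) ^ 2 ≤ (W 1 1 1 - 2) * (W 1 (2 * m - 1) 1 - 2 * m)) ∧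
    (∃ δ C : ℝ, 0 < δ ∧ ∀ k : ℕ, 1 ≤ k → W 1 k 1 - (k + 1) ≤ C * (k : ℝ) ^ (-δ)) ∧
    (∀ x : ℝ, 1 < x → DifferentiableAt ℝ (fun y : ℝ => W 1 y 1) x) := by
  refine ⟨fun x hx => ?_, fun m hm => ?_, ⟨1, 1 / 2, one_pos, fun k hk => ?_⟩, fun x hx => ?_⟩
  · rw [hyp_far hW hx]
    have : 0 < 1 / (2 * (x + 2)) := by positivity
    linarith
  · rw [hyp_far hW hm.le, hyp_far hW le_rfl, hyp_far hW (by linarith)]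
    have hm2 : (0 : ℝ) < m + 2 := by linarith
    have e1 : (m + 1 + 1 / (2 * (m + 2)) - (m + 1)) ^ 2 = 1 / (4 * (m + 2) ^ 2) := by
      field_simp [hm2.ne']
      ring
    have h2m : (0 : ℝ) < 2 * m - 1 + 2 := by linarith
    have h2m' : (0 : ℝ) < 2 * m + 1 := by linarith
    have e2 : ((1 : ℝ) + 1 + 1 / (2 * (1 + 2)) - 2) * (2 * m - 1 + 1 + 1 / (2 * (2 * m - 1 + 2)) - 2 * m)
        = 1 / (12 * (2 * m + 1)) := by
      field_simp [h2m.ne', h2m'.ne']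
      ring
    have hp1 : (0 : ℝ) < 4 * (m + 2) ^ 2 := mul_pos (by norm_num) (pow_pos (by linarith) 2)
    have hp2 : (0 : ℝ) < 12 * (2 * m + 1) := by linarith
    rw [e1, e2, div_le_div_iff₀ hp1 hp2]
    nlinarith [sq_nonneg (m - 1)]
  · have hk' : (1 : ℝ) ≤ k := by exact_mod_cast hk
    rw [hyp_far hW hk', Real.rpow_neg_one]
    have hk0 : (0 : ℝ) < k := by linarith
    rw [show (k : ℝ) + 1 + 1 / (2 * (k + 2)) - (k + 1) = 1 / (2 * (k + 2)) by ring,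
      show (1 / 2 : ℝ) * (k : ℝ)⁻¹ = 1 / (2 * k) by field_simp,
      div_le_div_iff₀ (by positivity) (by positivity)]
    linarith
  · have hev : (fun y : ℝ => W 1 y 1) =ᶠ[𝓝 x] fun y : ℝ => y + 1 + 1 / (2 * (y + 2)) := by
      filter_upwards [Ioi_mem_nhds hx] with y hy
      exact hyp_far hW (le_of_lt hy)
    rw [hev.differentiableAt_iff]
    have hx2 : 2 * (x + 2) ≠ 0 := by positivity
    fun_prop (disch := assumption)

/-- THEOREM-COMPATIBILITY of `W_hyp`: VXXZ table, `ω(1,1/3,5/3) = 8/3`, Coppersmith tight shapes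
(`r = 4/(1−t)`, a genuinely `t`-dependent length: `PolySaturation`-shape). -/
theorem hyp_compat :
    (∀ κ b : ℝ, (κ, b) ∈ vxxz2024Table → W 1 κ 1 ≤ b) ∧
    W 1 (1 / 3) (5 / 3) = 8 / 3 ∧
    (∀ t : ℝ, 0 ≤ t → t < 1 → ∃ r : ℝ, 1 ≤ r ∧ W 1 t r = 1 + r) := by
  refine ⟨fun κ b h => ?_, ?_, fun t ht0 ht1 => ?_⟩
  · simp only [vxxz2024Table, List.mem_cons, Prod.mk.injEq, List.not_mem_nil, or_false] at h
    rcases h with ⟨rfl, rfl⟩ | ⟨rfl, rfl⟩ | ⟨rfl, rfl⟩ | ⟨rfl, rfl⟩ | ⟨rfl, rfl⟩ | ⟨rfl, rfl⟩ |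
      ⟨rfl, rfl⟩ | ⟨rfl, rfl⟩ | ⟨rfl, rfl⟩ | ⟨rfl, rfl⟩ | ⟨rfl, rfl⟩ | ⟨rfl, rfl⟩ | ⟨rfl, rfl⟩ |
      ⟨rfl, rfl⟩ | ⟨rfl, rfl⟩ | ⟨rfl, rfl⟩ | ⟨rfl, rfl⟩ | ⟨rfl, rfl⟩ | ⟨rfl, rfl⟩ | ⟨rfl, rfl⟩ |
      ⟨rfl, rfl⟩ | ⟨rfl, rfl⟩ | ⟨rfl, rfl⟩ | ⟨rfl, rfl⟩
    all_goals (rw [hyp_pencil hW (by norm_num)]; norm_num [max_def])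
  · rw [hW]; norm_num [min_def, max_def]
  · refine ⟨4 / (1 - t), ?_, ?_⟩
    · rw [le_div_iff₀ (by linarith)]; linarith
    · have h1t : 0 < 1 - t := by linarith
      set r := 4 / (1 - t) with hr
      have hr4 : r * (1 - t) = 4 := by rw [hr]; field_simp
      have hr1 : 4 ≤ r := by rw [hr, le_div_iff₀ h1t]; linarith
      rw [hW]
      have hm : min (1 : ℝ) (min t r) = t := by
        rw [min_eq_left (by linarith : t ≤ r), min_eq_right (by linarith : t ≤ 1)]
      have hM : max (1 : ℝ) (max t r) = r := by
        rw [max_eq_right (by linarith : t ≤ r), max_eq_right (by linarith : (1 : ℝ) ≤ r)]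
      rw [hm, hM]
      have hp : 0 < 8 * (1 + t + r) := by linarith
      have key : 5 * (1 + t + r) / 8 + r / 4 + r ^ 2 / (8 * (1 + t + r)) - (1 + r) =
          ((1 + t) * (5 * (1 + t) - 8) - 4 * (r * (1 - t))) / (8 * (1 + t + r)) := by
        field_simp
        ring
      rw [hr4] at key
      have hneg : ((1 + t) * (5 * (1 + t) - 8) - 4 * 4) / (8 * (1 + t + r)) ≤ 0 :=
        div_nonpos_of_nonpos_of_nonneg (by nlinarith) hp.le
      rw [max_eq_left (by linarith)]
      ring

end Hyp

end Summit.MatrixMultiplication.MatrixMultiplication.Theorems.FarEdgeDescentSpectralHyp
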